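import Summits.CriticalPhenomena.CardyFormulaZ2.Theorems.CardyBoundaryCoulombGasBoundaryDefectGaussianRStubRealisabilityPart24
import Summits.CriticalPhenomena.CardyFormulaZ2.Theorems.CardyBoundaryCoulombGasBoundaryDefectGaussianRStubRealisabilityPart25

/-!
# Stub `stub_dictionaryPositivity` of line `rainbow-monomials-in-excursion-kernels` — Part 30:
# the rim of the cell region of a collar leg model is ONE simple traced polygon
# (registered sub-goal `s15_cellRegion_rim`; crux `BoundaryDefectGaussianR`,
# stmt-CriticalPhenomena-14132; insertion dictionary D2, layer 3c)

Third of three files (Parts 24, 25, 30). In the insertion dictionary D2 the heights of a rainbow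
configuration are built from combinatorial winding numbers of the strands closed by RIM ARCS of the
cell region `M.cellRegion` of the jump collar `M` (`CollarLegModelCellRegion.lean`); this needs the
rim to be one simple closed polygon of unit steps. With
`U = M.cellRegion.image (fun F ↦ ![F.1, F.2]) : Finset (Fin 2 → ℤ)` (inline everywhere) and the
cell-complex files `CellBoundary.lean` / `CellSides.lean`:

* `crr_pinchFree` — `CellComplex.PinchFree U`: the four cells at a medial point are the two vertex
  squares of the endpoints of a lattice edge and the two face squares of its side faces (Part 24),
  and the two checkerboard patterns are excluded by the local charts of `V` (Part 25), ghosts lying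
  in the first layer around `V`;
* `crr_coHoleFree` — `CellComplex.CoHoleFree U`: from a non-cell adjacent to `U` one reaches in two
  cell steps the vertex square of a FREE lattice point (no vertex of `V` among its king-neighbours:
  exit / far corner of Part 25), king paths through free points are chains of non-cells
  (`crr_freeChain_cells`), and the king-connectivity of the complement of `V`, pushed off the first
  layer (`crr_push`), reaches arbitrarily far free points;
* `crr_cellRegion_rim` / registered **`s15_cellRegion_rim`** — for `M : CollarLegModel` with `M.V`
  lattice-connected, with king-connected complement and locally charted at first-layer points
  (radius `6`; eventually true for the lattice approximations of a rectilinear Jordan domain), `U` is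
  pinch-free, edge-connected (Part 24) and co-hole-free, hence (`isSimpleClosedPolygon_traceList`,
  `exists_eq_bdOrbit_of_isBd`) for EVERY boundary dart `d₀` of `U` the traced vertex list
  `vert U d₀ i`, `i < period`, is a simple closed polygon of unit steps `cornerUnit (dirAt U d₀ i)`,
  every traced dart has its left cell in `U` and its right cell outside, and every boundary dart of
  `U` (every rim step: exactly one adjacent cell, on its left) lies on this single traced loop.

## The picture (exact evaluation in the session, `6 × 2` box `V = [0,5] × [0,1]`)

Medial coordinates: vertex `v ↦` square `(v₁ + v₂ - 1, v₂ - v₁)`, face `f ↦ (f₁ + f₂, f₂ - f₁)`; the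
rim is traced by `CellComplex.bdSucc` (region on the left).
```
closed collar (ofDomain V): vertexCells = V (12), faceCells = [-1,5]×[-1,1] (21), |U| = 33,
  36 boundary darts, ONE traced loop of period 36 from the dart ((0,3), south):
  (0,3)(0,2)(-1,2)(-1,1)(-2,1)(-2,0)(-1,0)(-1,-1)(0,-1)(0,-2)(1,-2)(1,-3)(2,-3)(2,-4)(3,-4)(3,-5)
  (4,-5)(4,-6)(5,-6)(5,-5)(6,-5)(6,-4)(7,-4)(7,-3)(6,-3)(6,-2)(5,-2)(5,-1)(4,-1)(4,0)(3,0)(3,1)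
  (2,1)(2,2)(1,2)(1,3) — a staircase diamond, no pinch point.
(1;1): source (1,0), sink (2,0): ghosts (1,-1),(2,-1) = squares (-1,-2),(0,-3); |U| = 35,
  36 boundary darts, ONE loop of period 36: as above except the teeth
  (-1,-1)(-1,-2)(0,-2)(0,-3)(1,-3) replacing (-1,-1)(0,-1)(0,-2)(1,-2)(1,-3).
(1,1;2): sources (1,0),(2,1), sink (2,0): 9 ghosts (2,2),(1,2),(0,2),(-1,2),(-1,1),(-1,0),(-1,-1),
  (0,-1),(1,-1) (the wired arc runs from (2,1) counter-clockwise round to (1,0)); |U| = 42,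
  40 boundary darts, ONE loop of period 40 from ((-2,-1), east):
  (-2,-1)(-1,-1)(-1,-2)(0,-2)(1,-2)(1,-3)(2,-3)(2,-4)(3,-4)(3,-5)(4,-5)(4,-6)(5,-6)(5,-5)(6,-5)
  (6,-4)(7,-4)(7,-3)(6,-3)(6,-2)(5,-2)(5,-1)(4,-1)(4,0)(4,1)(3,1)(3,2)(2,2)(2,3)(1,3)(1,4)(0,4)
  (0,3)(-1,3)(-1,2)(-2,2)(-2,1)(-3,1)(-3,0)(-2,0).
```
(These small boxes are pinch-free with a single rim although they are too small for the radius-`6`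
charts of the hypothesis; the hypothesis is the asymptotic one the crux needs.)

Everything is proved; no named fact is introduced.
-/

namespace Summit.CriticalPhenomena.CardyFormulaZ2.Cruxes.BoundaryDefectGaussianR.RainbowMonomialsInExcursionKernels

open Literature.Probability.LatticeModels Literature.Probability.LatticeModels.CollarLegModel
open Literature.Probability.Percolation Literature.Probability.Percolation.CellComplex

/-! ### Pinch-freeness of the cell region -/

/-- White pattern at a horizontal edge is impossible. [folklore] -/
theorem crr_pw_h (M : CollarLegModel)
    (hLS : ∀ z : ℤ × ℤ, z ∉ M.V → (∃ v ∈ M.V, max |v.1 - z.1| |v.2 - z.2| ≤ 1) → ∃ σ τ a c : ℤ, |σ| ≤ 1 ∧ |τ| ≤ 1 ∧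
      ((∀ v : ℤ × ℤ, max |v.1 - z.1| |v.2 - z.2| ≤ 6 → (v ∈ M.V ↔ 0 ≤ σ * (v.1 - a) ∧ 0 ≤ τ * (v.2 - c))) ∨
       (∀ v : ℤ × ℤ, max |v.1 - z.1| |v.2 - z.2| ≤ 6 → (v ∈ M.V ↔ 0 < σ * (v.1 - a) ∨ 0 < τ * (v.2 - c)))))
    {b : ℤ × ℤ} (h0 : (b.1, b.2) ∈ M.faceCells) (h2 : (b.1, b.2 - 1) ∈ M.faceCells)
    (h1 : (b.1, b.2) ∉ M.vertexCells) (h3 : (b.1 + 1, b.2) ∉ M.vertexCells) : False := by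
  have hb : b ∉ M.V := fun h ↦ h1 (by rw [Prod.mk.eta]; exact Finset.mem_union_left _ h)
  have hb' : (b.1 + 1, b.2) ∉ M.V := fun h ↦ h3 (Finset.mem_union_left _ h)
  obtain ⟨u, hu, hbu⟩ := (crr_mem_faceCells_iff M _).1 h0
  obtain ⟨u', hu', hbu'⟩ := (crr_mem_faceCells_iff M _).1 h2
  dsimp only at hbu hbu'
  exact crr_noPinchW_h hLS hb hb' ⟨u, hu, by omega⟩ ⟨u', hu', by omega⟩

/-- White pattern at a vertical edge is impossible. [folklore] -/
theorem crr_pw_v (M : CollarLegModel)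
    (hLS : ∀ z : ℤ × ℤ, z ∉ M.V → (∃ v ∈ M.V, max |v.1 - z.1| |v.2 - z.2| ≤ 1) → ∃ σ τ a c : ℤ, |σ| ≤ 1 ∧ |τ| ≤ 1 ∧
      ((∀ v : ℤ × ℤ, max |v.1 - z.1| |v.2 - z.2| ≤ 6 → (v ∈ M.V ↔ 0 ≤ σ * (v.1 - a) ∧ 0 ≤ τ * (v.2 - c))) ∨
       (∀ v : ℤ × ℤ, max |v.1 - z.1| |v.2 - z.2| ≤ 6 → (v ∈ M.V ↔ 0 < σ * (v.1 - a) ∨ 0 < τ * (v.2 - c)))))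
    {b : ℤ × ℤ} (h1 : (b.1 - 1, b.2) ∈ M.faceCells) (h3 : (b.1, b.2) ∈ M.faceCells)
    (h2 : (b.1, b.2) ∉ M.vertexCells) (h0 : (b.1, b.2 + 1) ∉ M.vertexCells) : False := by
  have hb : b ∉ M.V := fun h ↦ h2 (by rw [Prod.mk.eta]; exact Finset.mem_union_left _ h)
  have hb' : (b.1, b.2 + 1) ∉ M.V := fun h ↦ h0 (Finset.mem_union_left _ h)
  obtain ⟨u, hu, hbu⟩ := (crr_mem_faceCells_iff M _).1 h1
  obtain ⟨u', hu', hbu'⟩ := (crr_mem_faceCells_iff M _).1 h3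
  dsimp only at hbu hbu'
  exact crr_noPinchW_v hLS hb hb' ⟨u, hu, by omega⟩ ⟨u', hu', by omega⟩

/-- A vertex-cell outside `V` is a ghost, hence in the first layer. [folklore] -/
theorem crr_layer_of_vertexCell (M : CollarLegModel) {x : ℤ × ℤ} (hx : x ∈ M.vertexCells) (hxV : x ∉ M.V) :
    ∃ v ∈ M.V, max |v.1 - x.1| |v.2 - x.2| ≤ 1 := by
  rcases (crr_mem_vertexCells_iff M x).1 hx with h | h
  · exact absurd h hxV
  · exact (crr_ghost_layer M h).2

/-- Black pattern at a horizontal edge is impossible. [folklore] -/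
theorem crr_pb_h (M : CollarLegModel)
    (hLS : ∀ z : ℤ × ℤ, z ∉ M.V → (∃ v ∈ M.V, max |v.1 - z.1| |v.2 - z.2| ≤ 1) → ∃ σ τ a c : ℤ, |σ| ≤ 1 ∧ |τ| ≤ 1 ∧
      ((∀ v : ℤ × ℤ, max |v.1 - z.1| |v.2 - z.2| ≤ 6 → (v ∈ M.V ↔ 0 ≤ σ * (v.1 - a) ∧ 0 ≤ τ * (v.2 - c))) ∨
       (∀ v : ℤ × ℤ, max |v.1 - z.1| |v.2 - z.2| ≤ 6 → (v ∈ M.V ↔ 0 < σ * (v.1 - a) ∨ 0 < τ * (v.2 - c)))))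
    {b : ℤ × ℤ} (h1 : (b.1, b.2) ∈ M.vertexCells) (h3 : (b.1 + 1, b.2) ∈ M.vertexCells)
    (h0 : (b.1, b.2) ∉ M.faceCells) (h2 : (b.1, b.2 - 1) ∉ M.faceCells) : False := by
  rw [crr_mem_faceCells_iff] at h0 h2
  have nb : b ∉ M.V := fun h ↦ h0 ⟨b, h, by dsimp only; omega⟩
  have nb' : (b.1 + 1, b.2) ∉ M.V := fun h ↦ h0 ⟨_, h, by dsimp only; omega⟩
  have n1 : (b.1, b.2 + 1) ∉ M.V := fun h ↦ h0 ⟨_, h, by dsimp only; omega⟩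
  have n2 : (b.1, b.2 - 1) ∉ M.V := fun h ↦ h2 ⟨_, h, by dsimp only; omega⟩
  have n3 : (b.1 + 1, b.2 + 1) ∉ M.V := fun h ↦ h0 ⟨_, h, by dsimp only; omega⟩
  have n4 : (b.1 + 1, b.2 - 1) ∉ M.V := fun h ↦ h2 ⟨_, h, by dsimp only; omega⟩
  rw [Prod.mk.eta] at h1
  have hlb := crr_layer_of_vertexCell M h1 nb
  have hlb' := crr_layer_of_vertexCell M h3 nb'
  exact crr_noPinchB_h hLS nb nb' hlb hlb' n1 n2 n3 n4

/-- Black pattern at a vertical edge is impossible. [folklore] -/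
theorem crr_pb_v (M : CollarLegModel)
    (hLS : ∀ z : ℤ × ℤ, z ∉ M.V → (∃ v ∈ M.V, max |v.1 - z.1| |v.2 - z.2| ≤ 1) → ∃ σ τ a c : ℤ, |σ| ≤ 1 ∧ |τ| ≤ 1 ∧
      ((∀ v : ℤ × ℤ, max |v.1 - z.1| |v.2 - z.2| ≤ 6 → (v ∈ M.V ↔ 0 ≤ σ * (v.1 - a) ∧ 0 ≤ τ * (v.2 - c))) ∨
       (∀ v : ℤ × ℤ, max |v.1 - z.1| |v.2 - z.2| ≤ 6 → (v ∈ M.V ↔ 0 < σ * (v.1 - a) ∨ 0 < τ * (v.2 - c)))))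
    {b : ℤ × ℤ} (h0 : (b.1, b.2 + 1) ∈ M.vertexCells) (h2 : (b.1, b.2) ∈ M.vertexCells)
    (h1 : (b.1 - 1, b.2) ∉ M.faceCells) (h3 : (b.1, b.2) ∉ M.faceCells) : False := by
  rw [crr_mem_faceCells_iff] at h1 h3
  have nb : b ∉ M.V := fun h ↦ h3 ⟨b, h, by dsimp only; omega⟩
  have nb' : (b.1, b.2 + 1) ∉ M.V := fun h ↦ h3 ⟨_, h, by dsimp only; omega⟩
  have n1 : (b.1 - 1, b.2) ∉ M.V := fun h ↦ h1 ⟨_, h, by dsimp only; omega⟩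
  have n2 : (b.1 + 1, b.2) ∉ M.V := fun h ↦ h3 ⟨_, h, by dsimp only; omega⟩
  have n3 : (b.1 - 1, b.2 + 1) ∉ M.V := fun h ↦ h1 ⟨_, h, by dsimp only; omega⟩
  have n4 : (b.1 + 1, b.2 + 1) ∉ M.V := fun h ↦ h3 ⟨_, h, by dsimp only; omega⟩
  rw [Prod.mk.eta] at h2
  have hlb := crr_layer_of_vertexCell M h2 nb
  have hlb' := crr_layer_of_vertexCell M h0 nb'
  exact crr_noPinchB_v hLS nb nb' hlb hlb' n1 n2 n3 n4

/-- **The cell region of a model on a locally charted `V` is pinch-free.** [folklore] -/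
theorem crr_pinchFree (M : CollarLegModel)
    (hLS : ∀ z : ℤ × ℤ, z ∉ M.V → (∃ v ∈ M.V, max |v.1 - z.1| |v.2 - z.2| ≤ 1) → ∃ σ τ a c : ℤ, |σ| ≤ 1 ∧ |τ| ≤ 1 ∧
      ((∀ v : ℤ × ℤ, max |v.1 - z.1| |v.2 - z.2| ≤ 6 → (v ∈ M.V ↔ 0 ≤ σ * (v.1 - a) ∧ 0 ≤ τ * (v.2 - c))) ∨
       (∀ v : ℤ × ℤ, max |v.1 - z.1| |v.2 - z.2| ≤ 6 → (v ∈ M.V ↔ 0 < σ * (v.1 - a) ∨ 0 < τ * (v.2 - c))))) :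
    PinchFree (M.cellRegion.image (fun F : ℤ × ℤ ↦ (![F.1, F.2] : Fin 2 → ℤ))) := by
  intro w k hk
  rcases crr_medial_cases w with ⟨b, rfl⟩ | ⟨b, rfl⟩
  · obtain ⟨T0, T1, T2, T3⟩ := crr_faces_h M b
    fin_cases k
    · change faceAt _ 0 ∈ _ ∧ faceAt _ 2 ∈ _ ∧ faceAt _ 1 ∉ _ ∧ faceAt _ 3 ∉ _ at hk
      exact crr_pw_h M hLS (T0.1 hk.1) (T2.1 hk.2.1) (mt T1.2 hk.2.2.1) (mt T3.2 hk.2.2.2)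
    · change faceAt _ 1 ∈ _ ∧ faceAt _ 3 ∈ _ ∧ faceAt _ 2 ∉ _ ∧ faceAt _ 0 ∉ _ at hk
      exact crr_pb_h M hLS (T1.1 hk.1) (T3.1 hk.2.1) (mt T0.2 hk.2.2.2) (mt T2.2 hk.2.2.1)
    · change faceAt _ 2 ∈ _ ∧ faceAt _ 0 ∈ _ ∧ faceAt _ 3 ∉ _ ∧ faceAt _ 1 ∉ _ at hk
      exact crr_pw_h M hLS (T0.1 hk.2.1) (T2.1 hk.1) (mt T1.2 hk.2.2.2) (mt T3.2 hk.2.2.1)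
    · change faceAt _ 3 ∈ _ ∧ faceAt _ 1 ∈ _ ∧ faceAt _ 0 ∉ _ ∧ faceAt _ 2 ∉ _ at hk
      exact crr_pb_h M hLS (T1.1 hk.2.1) (T3.1 hk.1) (mt T0.2 hk.2.2.1) (mt T2.2 hk.2.2.2)
  · obtain ⟨T0, T1, T2, T3⟩ := crr_faces_v M b
    fin_cases k
    · change faceAt _ 0 ∈ _ ∧ faceAt _ 2 ∈ _ ∧ faceAt _ 1 ∉ _ ∧ faceAt _ 3 ∉ _ at hk
      exact crr_pb_v M hLS (T0.1 hk.1) (T2.1 hk.2.1) (mt T1.2 hk.2.2.1) (mt T3.2 hk.2.2.2)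
    · change faceAt _ 1 ∈ _ ∧ faceAt _ 3 ∈ _ ∧ faceAt _ 2 ∉ _ ∧ faceAt _ 0 ∉ _ at hk
      exact crr_pw_v M hLS (T1.1 hk.1) (T3.1 hk.2.1) (mt T2.2 hk.2.2.1) (mt T0.2 hk.2.2.2)
    · change faceAt _ 2 ∈ _ ∧ faceAt _ 0 ∈ _ ∧ faceAt _ 3 ∉ _ ∧ faceAt _ 1 ∉ _ at hk
      exact crr_pb_v M hLS (T0.1 hk.2.1) (T2.1 hk.1) (mt T1.2 hk.2.2.2) (mt T3.2 hk.2.2.1)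
    · change faceAt _ 3 ∈ _ ∧ faceAt _ 1 ∈ _ ∧ faceAt _ 0 ∉ _ ∧ faceAt _ 2 ∉ _ at hk
      exact crr_pw_v M hLS (T1.1 hk.2.1) (T3.1 hk.1) (mt T2.2 hk.2.2.2) (mt T0.2 hk.2.2.1)

/-! ### No holes -/

/-- A king path through free lattice points gives a chain of non-cells between the vertex squares. [folklore] -/
theorem crr_freeChain_cells (M : CollarLegModel) {x y : ℤ × ℤ}
    (h : Relation.ReflTransGen (fun p q : ℤ × ℤ ↦ (¬∃ v ∈ M.V, max |v.1 - p.1| |v.2 - p.2| ≤ 1) ∧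
      (¬∃ v ∈ M.V, max |v.1 - q.1| |v.2 - q.2| ≤ 1) ∧ max |p.1 - q.1| |p.2 - q.2| ≤ 1) x y) :
    Relation.ReflTransGen (fun a b ↦ a ∉ M.cellRegion.image (fun F : ℤ × ℤ ↦ (![F.1, F.2] : Fin 2 → ℤ)) ∧
      b ∉ M.cellRegion.image (fun F : ℤ × ℤ ↦ (![F.1, F.2] : Fin 2 → ℤ)) ∧ CellAdj a b)
      ![x.1 + x.2 - 1, x.2 - x.1] ![y.1 + y.2 - 1, y.2 - y.1] := by
  induction h with
  | refl => exact Relation.ReflTransGen.refl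
  | @tail p q _ hpq ih =>
    obtain ⟨hNp, hNq, hk⟩ := hpq
    rw [crr_max_abs_le_iff] at hk
    obtain ⟨g, hg⟩ : ∃ g : ℤ × ℤ, g = (min p.1 q.1, min p.2 q.2) := ⟨_, rfl⟩
    have hpg : g.1 ≤ p.1 ∧ p.1 ≤ g.1 + 1 ∧ g.2 ≤ p.2 ∧ p.2 ≤ g.2 + 1 := by rw [hg]; dsimp only; omega
    have hqg : g.1 ≤ q.1 ∧ q.1 ≤ g.1 + 1 ∧ g.2 ≤ q.2 ∧ q.2 ≤ g.2 + 1 := by rw [hg]; dsimp only; omega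
    have hgU : (![g.1 + g.2, g.2 - g.1] : Fin 2 → ℤ) ∉ M.cellRegion.image (fun F : ℤ × ℤ ↦ (![F.1, F.2] : Fin 2 → ℤ)) := by
      intro h
      obtain ⟨u, hu, hbox⟩ := (crr_mem_faceCells_iff M _).1 ((crr_mem_U_face M g.1 g.2).1 h)
      dsimp only at hbox
      exact hNp ⟨u, hu, crr_max_abs_le_iff.2 (by omega)⟩
    have hpU : (![p.1 + p.2 - 1, p.2 - p.1] : Fin 2 → ℤ) ∉ M.cellRegion.image (fun F : ℤ × ℤ ↦ (![F.1, F.2] : Fin 2 → ℤ)) :=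
      fun h ↦ crr_not_mem_vertexCells_of_free M hNp (by simpa only [Prod.mk.eta] using (crr_mem_U_vertex M p.1 p.2).1 h)
    have hqU : (![q.1 + q.2 - 1, q.2 - q.1] : Fin 2 → ℤ) ∉ M.cellRegion.image (fun F : ℤ × ℤ ↦ (![F.1, F.2] : Fin 2 → ℤ)) :=
      fun h ↦ crr_not_mem_vertexCells_of_free M hNq (by simpa only [Prod.mk.eta] using (crr_mem_U_vertex M q.1 q.2).1 h)
    exact (ih.tail ⟨hpU, hgU, (crr_cellAdj_of_corner hpg).1⟩).tail ⟨hgU, hqU, (crr_cellAdj_of_corner hqg).2⟩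

/-- **From a non-cell adjacent to the region to a free lattice point.** [folklore] -/
theorem crr_exit_cells (M : CollarLegModel)
    (hLS : ∀ z : ℤ × ℤ, z ∉ M.V → (∃ v ∈ M.V, max |v.1 - z.1| |v.2 - z.2| ≤ 1) → ∃ σ τ a c : ℤ, |σ| ≤ 1 ∧ |τ| ≤ 1 ∧
      ((∀ v : ℤ × ℤ, max |v.1 - z.1| |v.2 - z.2| ≤ 6 → (v ∈ M.V ↔ 0 ≤ σ * (v.1 - a) ∧ 0 ≤ τ * (v.2 - c))) ∨
       (∀ v : ℤ × ℤ, max |v.1 - z.1| |v.2 - z.2| ≤ 6 → (v ∈ M.V ↔ 0 < σ * (v.1 - a) ∨ 0 < τ * (v.2 - c)))))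
    {o : Fin 2 → ℤ} (ho : o ∉ M.cellRegion.image (fun F : ℤ × ℤ ↦ (![F.1, F.2] : Fin 2 → ℤ)))
    (hadj : ∃ c ∈ M.cellRegion.image (fun F : ℤ × ℤ ↦ (![F.1, F.2] : Fin 2 → ℤ)), CellAdj c o) :
    ∃ e : ℤ × ℤ, (¬∃ v ∈ M.V, max |v.1 - e.1| |v.2 - e.2| ≤ 1) ∧
      Relation.ReflTransGen (fun a b ↦ a ∉ M.cellRegion.image (fun F : ℤ × ℤ ↦ (![F.1, F.2] : Fin 2 → ℤ)) ∧
        b ∉ M.cellRegion.image (fun F : ℤ × ℤ ↦ (![F.1, F.2] : Fin 2 → ℤ)) ∧ CellAdj a b)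
        o ![e.1 + e.2 - 1, e.2 - e.1] := by
  obtain ⟨cU, hcU, hadj⟩ := hadj
  rcases crr_cell_cases o with ⟨b, rfl⟩ | ⟨f, rfl⟩
  · -- a vertex square outside the region, next to a face square of the region: `b` is in the first layer
    have hb : (b.1, b.2) ∉ M.vertexCells := fun h ↦ ho ((crr_mem_U_vertex M b.1 b.2).2 h)
    obtain ⟨f, rfl, hbf⟩ := crr_cellAdj_vertex_cases hadj.symm
    obtain ⟨u, hu, hub⟩ := (crr_mem_faceCells_iff M _).1 ((crr_mem_U_face M f.1 f.2).1 hcU)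
    dsimp only at hub
    have hbV : b ∉ M.V := fun h ↦ hb (Finset.mem_union_left _ (by rw [Prod.mk.eta]; exact h))
    obtain ⟨e, g, hbg, heg, hgfree, hNe⟩ := crr_exit hLS hbV ⟨u, hu, crr_max_abs_le_iff.2 (by omega)⟩
    have hgU : (![g.1 + g.2, g.2 - g.1] : Fin 2 → ℤ) ∉ M.cellRegion.image (fun F : ℤ × ℤ ↦ (![F.1, F.2] : Fin 2 → ℤ)) :=
      fun h ↦ crr_not_mem_faceCells_of_free M hgfree (by simpa only [Prod.mk.eta] using (crr_mem_U_face M g.1 g.2).1 h)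
    have heU : (![e.1 + e.2 - 1, e.2 - e.1] : Fin 2 → ℤ) ∉ M.cellRegion.image (fun F : ℤ × ℤ ↦ (![F.1, F.2] : Fin 2 → ℤ)) :=
      fun h ↦ crr_not_mem_vertexCells_of_free M hNe (by simpa only [Prod.mk.eta] using (crr_mem_U_vertex M e.1 e.2).1 h)
    exact ⟨e, hNe, Relation.ReflTransGen.head ⟨ho, hgU, (crr_cellAdj_of_corner hbg).1⟩
      (Relation.ReflTransGen.single ⟨hgU, heU, (crr_cellAdj_of_corner heg).2⟩)⟩
  · -- a face square outside the region, next to a vertex square of the region (a ghost)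
    have hf : (f.1, f.2) ∉ M.faceCells := fun h ↦ ho ((crr_mem_U_face M f.1 f.2).2 h)
    have hfree : ∀ u ∈ M.V, ¬(f.1 ≤ u.1 ∧ u.1 ≤ f.1 + 1 ∧ f.2 ≤ u.2 ∧ u.2 ≤ f.2 + 1) := fun u hu hbox ↦
      hf (by rw [Prod.mk.eta]; exact (crr_mem_faceCells_iff M f).2 ⟨u, hu, hbox⟩)
    obtain ⟨x, rfl, hxf⟩ := crr_cellAdj_face_cases hadj.symm
    have hx := (crr_mem_U_vertex M x.1 x.2).1 hcU
    rw [Prod.mk.eta] at hx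
    have hxV : x ∉ M.V := fun h ↦ hfree x h hxf
    obtain ⟨e, hef, hNe⟩ := crr_farCorner hLS hxf hxV (crr_layer_of_vertexCell M hx hxV) hfree
    refine ⟨e, hNe, Relation.ReflTransGen.single ⟨ho, ?_, (crr_cellAdj_of_corner hef).2⟩⟩
    exact fun h ↦ crr_not_mem_vertexCells_of_free M hNe (by simpa only [Prod.mk.eta] using (crr_mem_U_vertex M e.1 e.2).1 h)

/-- **The cell region of a model on a locally charted `V` with king-connected complement has no
holes.** [folklore] -/
theorem crr_coHoleFree (M : CollarLegModel)
    (hK : ∀ u ∉ M.V, ∀ w ∉ M.V, Relation.ReflTransGen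
      (fun b c : ℤ × ℤ ↦ b ∉ M.V ∧ c ∉ M.V ∧ max |b.1 - c.1| |b.2 - c.2| ≤ 1) u w)
    (hLS : ∀ z : ℤ × ℤ, z ∉ M.V → (∃ v ∈ M.V, max |v.1 - z.1| |v.2 - z.2| ≤ 1) → ∃ σ τ a c : ℤ, |σ| ≤ 1 ∧ |τ| ≤ 1 ∧
      ((∀ v : ℤ × ℤ, max |v.1 - z.1| |v.2 - z.2| ≤ 6 → (v ∈ M.V ↔ 0 ≤ σ * (v.1 - a) ∧ 0 ≤ τ * (v.2 - c))) ∨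
       (∀ v : ℤ × ℤ, max |v.1 - z.1| |v.2 - z.2| ≤ 6 → (v ∈ M.V ↔ 0 < σ * (v.1 - a) ∨ 0 < τ * (v.2 - c))))) :
    CoHoleFree (M.cellRegion.image (fun F : ℤ × ℤ ↦ (![F.1, F.2] : Fin 2 → ℤ))) := by
  intro o ho hadj R
  obtain ⟨b', hNb', hob'⟩ := crr_exit_cells M hLS ho hadj
  -- a far free target
  obtain ⟨B, hB⟩ : ∃ B : ℤ, ∀ v ∈ M.V, v.1 ≤ B :=
    ⟨∑ v ∈ M.V, |v.1|, fun v hv ↦ (le_abs_self _).trans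
      (Finset.single_le_sum (f := fun v : ℤ × ℤ ↦ |v.1|) (fun _ _ ↦ abs_nonneg _) hv)⟩
  obtain ⟨K, hKdef⟩ : ∃ K : ℤ, K = max (B + 2) (⌈R⌉ + 3) := ⟨_, rfl⟩
  have ht : ((K, 0) : ℤ × ℤ) ∉ M.V := fun h ↦ by have := hB _ h; dsimp only at this; omega
  have hb'V : b' ∉ M.V := fun h ↦ hNb' ⟨b', h, by simp⟩
  obtain ⟨y', hy't, hNy', hpath⟩ := crr_push hLS (hK b' hb'V (K, 0) ht) hNb'
  refine ⟨![y'.1 + y'.2 - 1, y'.2 - y'.1], ?_, hob'.trans (crr_freeChain_cells M hpath)⟩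
  rw [crr_max_abs_le_iff] at hy't
  have hint : (⌈R⌉ : ℤ) ≤ y'.1 + y'.2 - 1 := by omega
  have hcast : ((⌈R⌉ : ℤ) : ℝ) ≤ ((y'.1 + y'.2 - 1 : ℤ) : ℝ) := by exact_mod_cast hint
  have hre : R < (ctr (![y'.1 + y'.2 - 1, y'.2 - y'.1] : Fin 2 → ℤ)).re := by
    rw [ctr_re, Matrix.cons_val_zero]
    have := Int.le_ceil R
    linarith
  exact hre.trans_le (Complex.re_le_norm _)

/-! ### The rim: one simple traced polygon -/

/-- **The rim of the cell region is one simple traced polygon.** For a collar leg model `M` whose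
vertex set `V` is lattice-connected, has king-connected complement and is locally charted (within
sup-distance `6` of every first-layer point, `V` is a closed generalised quadrant or the complement of
one), the cell region `U` of `M` in the coordinates of `CellBoundary` is pinch-free, edge-connected and
co-hole-free; consequently, for every boundary dart `d₀` of `U`, the traced vertex list is a simple
closed polygon of unit steps, each traced dart has its left cell in `U` and its right cell outside, and
EVERY boundary dart of `U` lies on this one traced loop. [folklore] -/
theorem crr_cellRegion_rim (M : CollarLegModel)
    (hconn : ∀ u ∈ M.V, ∀ w ∈ M.V, Relation.ReflTransGen
      (fun b c : ℤ × ℤ ↦ b ∈ M.V ∧ c ∈ M.V ∧ (b.1 - c.1) ^ 2 + (b.2 - c.2) ^ 2 = 1) u w)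
    (hK : ∀ u ∉ M.V, ∀ w ∉ M.V, Relation.ReflTransGen
      (fun b c : ℤ × ℤ ↦ b ∉ M.V ∧ c ∉ M.V ∧ max |b.1 - c.1| |b.2 - c.2| ≤ 1) u w)
    (hLS : ∀ z : ℤ × ℤ, z ∉ M.V → (∃ v ∈ M.V, max |v.1 - z.1| |v.2 - z.2| ≤ 1) → ∃ σ τ a c : ℤ, |σ| ≤ 1 ∧ |τ| ≤ 1 ∧
      ((∀ v : ℤ × ℤ, max |v.1 - z.1| |v.2 - z.2| ≤ 6 → (v ∈ M.V ↔ 0 ≤ σ * (v.1 - a) ∧ 0 ≤ τ * (v.2 - c))) ∨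
       (∀ v : ℤ × ℤ, max |v.1 - z.1| |v.2 - z.2| ≤ 6 → (v ∈ M.V ↔ 0 < σ * (v.1 - a) ∨ 0 < τ * (v.2 - c))))) :
    PinchFree (M.cellRegion.image (fun F : ℤ × ℤ ↦ (![F.1, F.2] : Fin 2 → ℤ))) ∧
    EdgeConn (M.cellRegion.image (fun F : ℤ × ℤ ↦ (![F.1, F.2] : Fin 2 → ℤ))) ∧
    CoHoleFree (M.cellRegion.image (fun F : ℤ × ℤ ↦ (![F.1, F.2] : Fin 2 → ℤ))) ∧
    ∀ (d₀ : (Fin 2 → ℤ) × Fin 4) (h₀ : IsBd (M.cellRegion.image (fun F : ℤ × ℤ ↦ (![F.1, F.2] : Fin 2 → ℤ))) d₀),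
      Literature.Probability.RandomPlanarGeometry.IsSimpleClosedPolygon
        (traceList (M.cellRegion.image (fun F : ℤ × ℤ ↦ (![F.1, F.2] : Fin 2 → ℤ))) d₀ h₀) ∧
      (∀ i : ℕ, vert (M.cellRegion.image (fun F : ℤ × ℤ ↦ (![F.1, F.2] : Fin 2 → ℤ))) d₀ (i + 1) =
          vert (M.cellRegion.image (fun F : ℤ × ℤ ↦ (![F.1, F.2] : Fin 2 → ℤ))) d₀ i +
            cornerUnit (dirAt (M.cellRegion.image (fun F : ℤ × ℤ ↦ (![F.1, F.2] : Fin 2 → ℤ))) d₀ i) ∧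
        IsBd (M.cellRegion.image (fun F : ℤ × ℤ ↦ (![F.1, F.2] : Fin 2 → ℤ)))
          (bdOrbit (M.cellRegion.image (fun F : ℤ × ℤ ↦ (![F.1, F.2] : Fin 2 → ℤ))) d₀ i)) ∧
      ∀ d : (Fin 2 → ℤ) × Fin 4, IsBd (M.cellRegion.image (fun F : ℤ × ℤ ↦ (![F.1, F.2] : Fin 2 → ℤ))) d →
        ∃ i < CellComplex.period h₀, bdOrbit (M.cellRegion.image (fun F : ℤ × ℤ ↦ (![F.1, F.2] : Fin 2 → ℤ))) d₀ i = d := by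
  have hP := crr_pinchFree M hLS
  have hE := crr_edgeConn M hconn
  have hH := crr_coHoleFree M hK hLS
  exact ⟨hP, hE, hH, fun d₀ h₀ ↦ ⟨isSimpleClosedPolygon_traceList h₀ hP, fun i ↦ ⟨vert_succ i, isBd_bdOrbit h₀ i⟩,
    fun d hd ↦ exists_eq_bdOrbit_of_isBd h₀ hP hE hH hd⟩⟩

/-- **Registered sub-goal `s15_cellRegion_rim`** (one-line form of `crr_cellRegion_rim`): for a
collar leg model on a lattice-connected, locally charted vertex set with king-connected complement,
the transported cell region is pinch-free, edge-connected and co-hole-free, and for every boundary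
dart the traced rim is a simple closed polygon of unit steps carrying every boundary dart.
[folklore] -/
theorem s15_cellRegion_rim : ∀ (M : Literature.Probability.LatticeModels.CollarLegModel), (∀ u ∈ M.V, ∀ w ∈ M.V, Relation.ReflTransGen (fun b c : ℤ × ℤ ↦ b ∈ M.V ∧ c ∈ M.V ∧ (b.1 - c.1) ^ 2 + (b.2 - c.2) ^ 2 = 1) u w) → (∀ u ∉ M.V, ∀ w ∉ M.V, Relation.ReflTransGen (fun b c : ℤ × ℤ ↦ b ∉ M.V ∧ c ∉ M.V ∧ max |b.1 - c.1| |b.2 - c.2| ≤ 1) u w) → (∀ z : ℤ × ℤ, z ∉ M.V → (∃ v ∈ M.V, max |v.1 - z.1| |v.2 - z.2| ≤ 1) → ∃ σ τ a c : ℤ, |σ| ≤ 1 ∧ |τ| ≤ 1 ∧ ((∀ v : ℤ × ℤ, max |v.1 - z.1| |v.2 - z.2| ≤ 6 → (v ∈ M.V ↔ 0 ≤ σ * (v.1 - a) ∧ 0 ≤ τ * (v.2 - c))) ∨ (∀ v : ℤ × ℤ, max |v.1 - z.1| |v.2 - z.2| ≤ 6 → (v ∈ M.V ↔ 0 < σ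 * (v.1 - a) ∨ 0 < τ * (v.2 - c))))) → Literature.Probability.Percolation.CellComplex.PinchFree (M.cellRegion.image (fun F : ℤ × ℤ ↦ (![F.1, F.2] : Fin 2 → ℤ))) ∧ Literature.Probability.Percolation.CellComplex.EdgeConn (M.cellRegion.image (fun F : ℤ × ℤ ↦ (![F.1, F.2] : Fin 2 → ℤ))) ∧ Literature.Probability.Percolation.CellComplex.CoHoleFree (M.cellRegion.image (fun F : ℤ × ℤ ↦ (![F.1, F.2] : Fin 2 → ℤ))) ∧ ∀ (d₀ : (Fin 2 → ℤ) × Fin 4) (h₀ : Literature.Probability.Percolation.CellComplex.IsBd (M.cellRegion.image (fun F : ℤ × ℤ ↦ (![F.1, F.2] : Fin 2 → ℤ))) d₀), Literature.Probability.RandomPlanarGeometry.IsSimpleClosedPolygon (Literature.Probability.Percolation.CellComplex.traceList (M.cellRegion.image (fun F : ℤ × ℤ ↦ (![F.1, F.2] : Fin 2 → ℤ))) d₀ h₀) ∧ (∀ i : ℕ, Literature.Probability.Percolation.CellComplex.vert (M.cellRegion.image (fun F : ℤ × ℤ ↦ (![F.1, F.2] : Fin 2 → ℤ))) d₀ (i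 + 1) = Literature.Probability.Percolation.CellComplex.vert (M.cellRegion.image (fun F : ℤ × ℤ ↦ (![F.1, F.2] : Fin 2 → ℤ))) d₀ i + Literature.Probability.LatticeModels.cornerUnit (Literature.Probability.Percolation.CellComplex.dirAt (M.cellRegion.image (fun F : ℤ × ℤ ↦ (![F.1, F.2] : Fin 2 → ℤ))) d₀ i) ∧ Literature.Probability.Percolation.CellComplex.IsBd (M.cellRegion.image (fun F : ℤ × ℤ ↦ (![F.1, F.2] : Fin 2 → ℤ))) (Literature.Probability.Percolation.CellComplex.bdOrbit (M.cellRegion.image (fun F : ℤ × ℤ ↦ (![F.1, F.2] : Fin 2 → ℤ))) d₀ i)) ∧ ∀ d : (Fin 2 → ℤ) × Fin 4, Literature.Probability.Percolation.CellComplex.IsBd (M.cellRegion.image (fun F : ℤ × ℤ ↦ (![F.1, F.2] : Fin 2 → ℤ))) d → ∃ i < Literature.Probability.Percolation.CellComplex.period h₀, Literature.Probability.Percolation.CellComplex.bdOrbit (M.cellRegion.image (fun F : ℤ × ℤ ↦ (![F.1, F.2] : Fin 2 → ℤ))) d₀ i = d :=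
  fun M hconn hK hLS ↦ crr_cellRegion_rim M hconn hK hLS

end Summit.CriticalPhenomena.CardyFormulaZ2.Cruxes.BoundaryDefectGaussianR.RainbowMonomialsInExcursionKernels
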